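/-
Copyright: the b2b-balaban cell (near-miss cell 7), T⁴-continuum fan-out, NE7b ROUND-2 swarm `t4-ne7b-formalise-*`
(seat leaf-07, gen 2), row S6f «window-drop steps in the zone calculus» of lineage t4-ne7b-p1's claim table
`LEAVES-NE7b.md` (R-OWNER-22-2 (U2)).  Part Id: the clamped profile (remedy R7-b of typer T-NE7b-7 ∕ F-leaf07-1).
Released under the licence of the surrounding project.
-/
import Summits.QuantumFields.BalabanUV.T4Continuum.Support.HistoryLevelsFlow

/-!
# History levels, Id: the CLAMPED window-exponent profile — drop control on every horizon, per-cutoff package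

Summits-side support leaf of the T⁴-continuum cell (rung (B)+1 on a FINITE torus only; NOT infinite volume, NOT the
mass gap, NOT the Clay statement; NOT a proof of the spine estimate NE7b).  NE7b ROUND-2 swarm, row **S6f**, supplier
for remedy R7-b of the typer's T-NE7b-7 = finding F-leaf07-1 (the END's S-profile must be PER RUN: `s K :=` the
exponent profile of the cutoff-`K` run's sizes `R K`, frozen beyond the cutoff).  `HistoryLevelsFlow.dropCtl_expOf`
gives `DropCtl (expOf L R) K` up to the cutoff; leaf-08's geometric lemmas (`HistoryRealise.dropCtl_from`) ask for
`∀ m, DropCtl s m`; the CLAMPED profile `clampExp s K t := s (min t K)` has it (a constant tail has no drops), keeps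
`R t = L ^ s t` on `[0, K]`, and has the same model scale (`levelOf_clampExp`).  This is the profile leaf-02 g2's
`HistoryAssemblyRealiseRun.runProfile L R K t := expOf L (R K) (min t K)` denotes — ONE profile in the tree (typer
LEAVES v2.9 name sync).  [folklore] bookkeeping; nothing printed asserted; no `[cite:]` tag; no `Prop` fact minted.
(Filed as its own module because the v2 append of `HistoryLevelsFlow` carrying the same four declarations, p211564,
sits in the append∕review lane; whichever lands second bounces on `dedup.fqn-exists` — one copy in the tree.)

WHAT.  `clampExp`, `clampExp_of_le`, `levelOf_clampExp`, **`dropCtl_clampExp`** (`DropCtl s K → ∀ m, DropCtl (clampExp s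
K) m`), **`flowProfile_of_flow`** (per cutoff, from `Step.InInterval`, `γ ≤ 1`, monotone couplings, (2.5) `B14.IsRj` at
every step, (2.7) `B14.FlowIneq27` with the size exponent, and the located smallness of `B16SProfile.dropCtl_of_27b`:
`(∀ m, DropCtl (clampExp (expOf L R) K) m) ∧ (∀ t ≤ K, R t = L ^ clampExp (expOf L R) K t) ∧
LevelFn K (levelOf (clampExp (expOf L R) K) K)`); sanity.

HONEST DEPENDENCY (cell): continuum YM on T⁴ ⇐ BetaPertH ∧ nine spine estimates (0/9 proved); BetaPertH ⇐ (D1) ∧ (D4)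
∧ CAP+tail; G-an2-4 gates asym, D1 and NE2/3/4.  This file changes none of it.  NE7b NOT proved.
-/

open Literature.MathematicalPhysics.QuantumFieldTheory.Balaban1983to89

namespace Summit.QuantumFields.BalabanUV.T4Continuum.HistoryZones

noncomputable section

/-! ## §1 The clamped profile -/

/-- THE CLAMPED PROFILE: the exponent sequence frozen at its cutoff value beyond the cutoff (the run has no steps there;
`HistoryRealise.dropCtl_from` asks for drop control on all horizons). [folklore] -/
def clampExp (s : ℕ → ℕ) (K : ℕ) (t : ℕ) : ℕ := s (min t K)

/-- below the cutoff the clamped profile is the profile [folklore] -/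
theorem clampExp_of_le {s : ℕ → ℕ} {K t : ℕ} (ht : t ≤ K) : clampExp s K t = s t := by
  rw [clampExp, min_eq_left ht]

/-- the model scale does not see the clamping [folklore] -/
theorem levelOf_clampExp (s : ℕ → ℕ) (K : ℕ) : levelOf (clampExp s K) K = levelOf s K := by
  funext t
  simp [levelOf, clampExp]

/-- **DROP CONTROL UP TO THE CUTOFF EXTENDS TO EVERY HORIZON** for the clamped profile. [folklore] -/
theorem dropCtl_clampExp {s : ℕ → ℕ} {K : ℕ} (h : B16SProfile.DropCtl s K) (m : ℕ) :
    B16SProfile.DropCtl (clampExp s K) m := by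
  intro i k hik _
  simp only [clampExp]
  rcases le_or_gt k K with hkK | hKk
  · rw [min_eq_left hkK, min_eq_left (by omega : i ≤ K)]
    exact h i k hik hkK
  · rw [min_eq_right hKk.le]
    rcases lt_or_ge i K with hiK | hKi
    · rw [min_eq_left hiK.le]
      have h1 := h i K hiK le_rfl
      have h2 : max (K - i) 2 ≤ max (k - i) 2 := max_le_max (by omega) le_rfl
      omega
    · rw [min_eq_right hKi]
      omega

/-- **THE ASSEMBLY'S PER-CUTOFF PACKAGE FROM THE FLOW**: for the cutoff-`K` run, the clamped exponent profile of its
sizes `R` is drop-controlled on every horizon (the display `∀ m, DropCtl s m` of `HistoryRealise` ∕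
`HistoryAssemblyRealiseLE`, DERIVED), it recovers `R t = L ^ s t` on `[0, K]`, and its model scale is a level function.
[folklore] -/
theorem flowProfile_of_flow {L : ℕ} (hL : 2 ≤ L) {r K : ℕ} {g : ℕ → ℝ} {γ β' β₀ : ℝ} {R : ℕ → ℕ}
    (hI : Step.InInterval γ K g) (hγ1 : γ ≤ 1) (hmono : ∀ n, n < K → g n ≤ g (n + 1))
    (hR : ∀ t, t ≤ K → B14.IsRj L r (g t) (R t)) (h27 : B14.FlowIneq27 g β' β₀ r K)
    (hΘ : ∀ m n, m < n → n ≤ K → (1 + (g n) ^ 2 * β' * ((n : ℝ) - m)) ^ β₀ ≤ (L : ℝ) ^ (max (n - m) 2 / 2)) :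
    (∀ m, B16SProfile.DropCtl (clampExp (expOf L R) K) m) ∧
      (∀ t, t ≤ K → R t = L ^ clampExp (expOf L R) K t) ∧ LevelFn K (levelOf (clampExp (expOf L R) K) K) := by
  refine ⟨dropCtl_clampExp (dropCtl_expOf hL hI hγ1 hR h27 hΘ), fun t ht => ?_, ?_⟩
  · rw [clampExp_of_le ht]; exact pow_expOf_eq hL hR ht
  · rw [levelOf_clampExp]; exact levelFn_of_flow hL hI hγ1 hmono hR h27 hΘ

/-! ## §2 Sanity (decided) -/

namespace SanityLC

/-- sizes `27,27,9,9,3,3` in base `3`, cutoff `5`: the clamped exponent profile stays at `1` beyond the cutoff -/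
example : (List.range 8).map (clampExp (expOf 3 fun t => [27, 27, 9, 9, 3, 3].getD t 1) 5) = [3, 3, 2, 2, 1, 1, 1, 1] := by
  decide

end SanityLC

end

end Summit.QuantumFields.BalabanUV.T4Continuum.HistoryZones
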